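import Mathlib
import Literature.Claims.NS.Kampen2014

/-!
# SoloRefuteKampen2014 — C13 `Kampen2014` (arXiv:1309.4824 v11): kernel refutation of the typed `Step_3` ((359) p.72)
Author: referee lane 3 (ns-claims-ref-3); filed unchanged by the paired salvage prover (convention (b)). Typed skeleton:
`Literature.Claims.NS.Kampen2014` (typist-12, p467160 + rev 2 p469095).
Kernel record for the REF-3 verdict: (i) the typed `Step_3` ((359) p.72 at the q = 1 grain) is FALSE by a
print-realisable witness — the maximal-loss norm-along-time `N(σ) = 1 − σ/(1+t₀)` (loss exactly the printed
allowance `μ ≤ μ(0) = 1/(1+t₀)`), at `t₀ = 0`, `α = 1/2`, `Δ₁ = 1/2`; (ii) `Step_3Scalar` is false at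
`t₀ = 0, α = 1/2, Δ = 1/16` (`√3/16 ≤ 1/16` fails); (iii) the ONE charitable re-typing of record, R#a = (359)
with `α = 1` at its scalar core (`Step_3A`: the damping weight integrated over any sub-step of the half-step
grid is `≥ c_{μ,t₀}·Δ`), HOLDS — proved from (357) pointwise and monotonicity of the integral — so the
chain SURVIVES (359) under R#a; (iv) it then breaks at the same-constant transfer (308) p.63: `Step_6Abs`
is false at `ρ = 1/2, t₀ = 0, t = 1/4, U = C = 1` (`3/2 ≤ 5/4` fails), which the print's own Remark 6.7
concedes; the weak transfer `Step_6Weak` (316) is true (`step_6Weak_holds`), and after it the restart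
induction of p.65 is not carried out (unfilled gap; ρ = ρ(C) by (369) p.75).
WHAT THIS IS NOT: not a claim about NS regularity or blow-up; not a claim about any author beyond the typed locator.
-/

-- The summit's canonical theorem namespace repeats the summit name (single-conjunct summit).
set_option linter.dupNamespace false

namespace Summit.NavierStokesRegularity.NavierStokesRegularity.Theorems.Kampen2014

open Literature.Claims.NS.Kampen2014

/-! ### Shape lemmas (from retype-Kampen2014-shape.lean, 1768ca3006635659) -/

/-- Scalar core of the (359) shape: for `α < 1` and `M, c > 0`, `M·Δ < c·Δ^α` for all small `Δ > 0`. -/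
theorem gain_lt_of_small_step (α M c : ℝ) (hα1 : α < 1) (hM : 0 < M) (hc : 0 < c) :
    ∃ Δ₀ > 0, ∀ Δ, 0 < Δ → Δ < Δ₀ → M * Δ < c * Δ ^ α := by
  refine ⟨(c / M) ^ (1 / (1 - α)), by positivity, ?_⟩
  intro Δ hΔ hlt
  have h1α : 0 < 1 - α := by linarith
  have hpow : Δ ^ (1 - α) < c / M := by
    have := Real.rpow_lt_rpow hΔ.le hlt h1α
    rwa [← Real.rpow_mul (by positivity), one_div, inv_mul_cancel₀ h1α.ne', Real.rpow_one] at this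
  have hsplit : Δ = Δ ^ α * Δ ^ (1 - α) := by
    rw [← Real.rpow_add hΔ]; simp
  have hΔα : 0 < Δ ^ α := Real.rpow_pos_of_pos hΔ α
  calc M * Δ = M * (Δ ^ α * Δ ^ (1 - α)) := by rw [← hsplit]
    _ = Δ ^ α * (M * Δ ^ (1 - α)) := by ring
    _ < Δ ^ α * c := by
        apply mul_lt_mul_of_pos_left _ hΔα
        calc M * Δ ^ (1 - α) < M * (c / M) := by exact mul_lt_mul_of_pos_left hpow hM
          _ = c := by field_simp
    _ = c * Δ ^ α := by ring

/-- An abstract norm-along-time `N` with the one-step Lipschitz loss `N t − N(t+Δ) ≤ M Δ N t` cannot satisfy the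
(359)-type gain `N(t+Δ) ≤ N t − c Δ^α N t` for all small `Δ` at a time with `N t > 0`. -/
theorem not_damping_gain_of_lipschitz_step (N : ℝ → ℝ) (t α M c Δ₁ : ℝ) (hα1 : α < 1) (hM : 0 < M)
    (hc : 0 < c) (hΔ₁ : 0 < Δ₁) (hNt : 0 < N t)
    (hlip : ∀ Δ, 0 < Δ → Δ < Δ₁ → N t - N (t + Δ) ≤ M * Δ * N t) :
    ¬ (∀ Δ, 0 < Δ → Δ < Δ₁ → N (t + Δ) ≤ N t - c * Δ ^ α * N t) := by
  intro hgain
  obtain ⟨Δ₀, hΔ₀, hsmall⟩ := gain_lt_of_small_step α M c hα1 hM hc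
  set Δ := min Δ₀ Δ₁ / 2 with hΔdef
  have hΔpos : 0 < Δ := by positivity
  have hΔlt₀ : Δ < Δ₀ := by
    have : min Δ₀ Δ₁ ≤ Δ₀ := min_le_left _ _
    linarith
  have hΔlt₁ : Δ < Δ₁ := by
    have : min Δ₀ Δ₁ ≤ Δ₁ := min_le_right _ _
    linarith
  have h1 := hlip Δ hΔpos hΔlt₁
  have h2 := hgain Δ hΔpos hΔlt₁
  have h3 := hsmall Δ hΔpos hΔlt₀
  have h4 : c * Δ ^ α * N t ≤ M * Δ * N t := by linarith
  have h5 : c * Δ ^ α ≤ M * Δ := le_of_mul_le_mul_right h4 hNt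
  linarith

/-! ### Numerics -/

/-- Numerics: `√3 ≤ 2`. -/
theorem sqrt3_le_two : Real.sqrt 3 ≤ 2 := by
  have : Real.sqrt 4 = 2 := by
    rw [show (4 : ℝ) = 2 ^ 2 by norm_num, Real.sqrt_sq (by norm_num)]
  calc Real.sqrt 3 ≤ Real.sqrt 4 := Real.sqrt_le_sqrt (by norm_num)
    _ = 2 := this

/-- Numerics: `1/2 ≤ 1/√3`. -/
theorem half_le_inv_sqrt3 : (1 : ℝ) / 2 ≤ 1 / Real.sqrt 3 :=
  one_div_le_one_div_of_le (by positivity) sqrt3_le_two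

/-- Numerics: the printed constant `c_{μ,0} = 3√3/12` is positive. -/
theorem cmuLow_zero_pos : 0 < cmuLow 0 := by
  unfold cmuLow; positivity

/-! ### (i) `Step_3` as typed is false — maximal-loss witness `N σ = 1 − σ` at `t₀ = 0` -/

/-- **The typed `Step_3` ((359) p.72 at the q = 1 grain) is FALSE**: witness `N σ = 1 − σ` (maximal loss, exactly the
printed allowance `μ ≤ 1/(1+t₀)`) at `t₀ = 0`, `α = 1/2`, `Δ₁ = 1/2`. -/
theorem not_Step_3 : ¬ Step_3 := by
  intro h
  have h1 := h 0 le_rfl (1 / 2) (by norm_num) (by norm_num) (1 / 2) (by norm_num) half_le_inv_sqrt3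
    (fun σ => 1 - σ) 0 le_rfl (by norm_num)
    (by intro Δ hΔ _; simp; try linarith)
  exact not_damping_gain_of_lipschitz_step (fun σ => 1 - σ) 0 (1 / 2) 1 (cmuLow 0) (1 / 2)
    (by norm_num) one_pos cmuLow_zero_pos (by norm_num) (by norm_num)
    (by intro Δ hΔ _; simp; try linarith) h1

/-! ### (ii) `Step_3Scalar` is false at `t₀ = 0, α = 1/2, Δ = 1/16` -/

/-- **`Step_3Scalar` is FALSE** at `t₀ = 0`, `α = 1/2`, `Δ = 1/16` (`√3/16 ≤ 1/16` fails). -/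
theorem not_Step_3Scalar : ¬ Step_3Scalar := by
  intro h
  have h1 := h 0 le_rfl (1 / 2) (by norm_num) (by norm_num) (1 / 16) (by norm_num)
    (le_trans (by norm_num) half_le_inv_sqrt3)
  have hpow : ((1 : ℝ) / 16) ^ ((1 : ℝ) / 2) = 1 / 4 := by
    rw [← Real.sqrt_eq_rpow, show ((1 : ℝ) / 16) = (1 / 4) ^ 2 by norm_num, Real.sqrt_sq (by norm_num)]
  rw [hpow] at h1
  unfold cmuLow at h1
  have hs3 : 1 < Real.sqrt 3 := by
    rw [show (1 : ℝ) = Real.sqrt 1 by simp]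
    exact Real.sqrt_lt_sqrt (by norm_num) (by norm_num)
  nlinarith [h1, hs3]

/-! ### (iii) R#a — (359) with `α = 1` at its scalar core HOLDS -/

/-- R#a (charitable re-typing of record): (359) with `α = 1`, scalar core — over every sub-step
`[σ₀, σ₀ + Δ]` of the half-step grid `[0, 1/√3]` the integrated damping weight is at least `c_{μ,t₀}·Δ`
(the print's own justification «as μ(s) > c_{μ,t₀}»). -/
def Step_3A : Prop :=
  ∀ t₀ : ℝ, 0 ≤ t₀ → ∀ σ₀ Δ : ℝ, 0 ≤ σ₀ → 0 < Δ → σ₀ + Δ ≤ 1 / Real.sqrt 3 →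
    cmuLow t₀ * Δ ≤ ∫ s in σ₀..σ₀ + Δ, muOf t₀ s

/-- The shifted clock `τ(σ) = t₀ + σ/√(1+σ²)` is `≥ t₀` for `σ ≥ 0`. -/
theorem tau_shift_ge (t₀ σ : ℝ) (hσ : 0 ≤ σ) : t₀ ≤ tauOf t₀ σ := by
  unfold tauOf
  have : 0 ≤ σ / Real.sqrt (1 + σ ^ 2) := by positivity
  linarith

/-- `1 + τ(σ) > 0` for `t₀ ≥ 0` (since `|σ| < √(1+σ²)`). -/
theorem one_add_tau_pos (t₀ σ : ℝ) (ht₀ : 0 ≤ t₀) : 0 < 1 + tauOf t₀ σ := by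
  unfold tauOf
  have hs : 0 < Real.sqrt (1 + σ ^ 2) := Real.sqrt_pos.2 (by positivity)
  have habs : |σ| < Real.sqrt (1 + σ ^ 2) := by
    rw [Real.lt_sqrt (abs_nonneg σ), sq_abs]; linarith
  have hlow : -Real.sqrt (1 + σ ^ 2) < σ := by
    have := (abs_lt.1 habs).1; linarith
  have : -1 < σ / Real.sqrt (1 + σ ^ 2) := by
    rw [lt_div_iff₀ hs]; linarith
  linarith

/-- (357) p.72 pointwise: `c_{μ,t₀} ≤ μ(σ)` on `σ ∈ [0, 1/√3]`. -/
theorem mu_lower (t₀ : ℝ) (ht₀ : 0 ≤ t₀) (σ : ℝ) (hσ : σ ∈ Set.Icc 0 (1 / Real.sqrt 3)) :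
    cmuLow t₀ ≤ muOf t₀ σ := by
  obtain ⟨hσ0, hσ1⟩ := hσ
  have hs3 : 0 < Real.sqrt 3 := by positivity
  have hs3sq : Real.sqrt 3 ^ 2 = 3 := Real.sq_sqrt (by norm_num)
  have hσsq : σ ^ 2 ≤ 1 / 3 := by
    have := pow_le_pow_left₀ hσ0 hσ1 2
    rwa [div_pow, one_pow, hs3sq] at this
  have hsqrt_pos : 0 < Real.sqrt (1 + σ ^ 2) := Real.sqrt_pos.2 (by positivity)
  -- τ(σ) ≤ t₀ + 1/2
  have hτ : tauOf t₀ σ ≤ t₀ + 1 / 2 := by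
    unfold tauOf
    have h2 : 2 * σ ≤ Real.sqrt (1 + σ ^ 2) := by
      rw [Real.le_sqrt (by positivity) (by positivity)]
      nlinarith
    have : σ / Real.sqrt (1 + σ ^ 2) ≤ 1 / 2 := by
      rw [div_le_iff₀ hsqrt_pos]; linarith
    linarith
  have hτpos : 0 < 1 + tauOf t₀ σ := one_add_tau_pos t₀ σ ht₀
  -- A = (1+σ²)^{3/2} ≤ 8/(3√3)
  set A := (1 + σ ^ 2) ^ ((3 : ℝ) / 2) with hA
  have hApos : 0 < A := Real.rpow_pos_of_pos (by positivity) _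
  have hAsq : A ^ 2 = (1 + σ ^ 2) ^ 3 := by
    rw [hA, ← Real.rpow_natCast, ← Real.rpow_mul (by positivity)]
    norm_num
  have hB : 0 < 8 / (3 * Real.sqrt 3) := by positivity
  have hAle : A ≤ 8 / (3 * Real.sqrt 3) := by
    rw [← pow_le_pow_iff_left₀ hApos.le hB.le two_ne_zero, hAsq, div_pow, mul_pow, hs3sq]
    rw [le_div_iff₀ (by norm_num)]
    nlinarith [hσsq, sq_nonneg σ, sq_nonneg (σ ^ 2)]
  -- μ(σ) = A⁻¹ / (1 + τ)
  have hmu : muOf t₀ σ = A⁻¹ / (1 + tauOf t₀ σ) := by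
    rw [muOf, show (-(3 : ℝ) / 2) = -((3 : ℝ) / 2) by ring, Real.rpow_neg (by positivity)]
  rw [hmu, le_div_iff₀ hτpos]
  -- cmuLow t₀ * (1 + τ) ≤ cmuLow t₀ * (3/2 + t₀) = 3√3/8 ≤ A⁻¹
  have hc : cmuLow t₀ * (3 / 2 + t₀) = 3 * Real.sqrt 3 / 8 := by
    unfold cmuLow
    field_simp
    ring
  have hcpos : 0 < cmuLow t₀ := by unfold cmuLow; positivity
  have h1 : cmuLow t₀ * (1 + tauOf t₀ σ) ≤ 3 * Real.sqrt 3 / 8 := by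
    rw [← hc]
    exact mul_le_mul_of_nonneg_left (by linarith) hcpos.le
  have h2 : 3 * Real.sqrt 3 / 8 ≤ A⁻¹ := by
    rw [le_inv_comm₀ (by positivity) hApos, inv_div]
    exact hAle
  linarith

/-- The damping weight `μ(σ) = (1+σ²)^{−3/2}/(1+τ(σ))` is continuous for `t₀ ≥ 0`. -/
theorem muOf_continuous (t₀ : ℝ) (ht₀ : 0 ≤ t₀) : Continuous (muOf t₀) := by
  have hnum : Continuous fun σ : ℝ => (1 + σ ^ 2) ^ (-(3 : ℝ) / 2) :=
    (by fun_prop : Continuous fun σ : ℝ => 1 + σ ^ 2).rpow_const (fun x => Or.inl (by positivity))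
  have hsq : Continuous fun σ : ℝ => Real.sqrt (1 + σ ^ 2) := by fun_prop
  have hden : Continuous fun σ : ℝ => 1 + tauOf t₀ σ := by
    unfold tauOf
    exact continuous_const.add (continuous_const.add (continuous_id.div hsq fun x => by
      exact (Real.sqrt_pos.2 (by positivity)).ne'))
  have : muOf t₀ = fun σ => (1 + σ ^ 2) ^ (-(3 : ℝ) / 2) / (1 + tauOf t₀ σ) := by
    funext σ; rfl
  rw [this]
  exact hnum.div hden (fun x => (one_add_tau_pos t₀ x ht₀).ne')

/-- **R#a HOLDS** (the ONE charitable re-typing of record): (359) with `α = 1` at its scalar core — the damping weight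
integrated over any sub-step of `[0, 1/√3]` is `≥ c_{μ,t₀}·Δ` — proved from (357) pointwise (`mu_lower`) and
monotonicity of the integral. -/
theorem step_3A_holds : Step_3A := by
  intro t₀ ht₀ σ₀ Δ hσ₀ hΔ hgrid
  have hint : IntervalIntegrable (muOf t₀) MeasureTheory.volume σ₀ (σ₀ + Δ) :=
    (muOf_continuous t₀ ht₀).intervalIntegrable _ _
  calc cmuLow t₀ * Δ = ∫ _ in σ₀..σ₀ + Δ, cmuLow t₀ := by
        rw [intervalIntegral.integral_const, smul_eq_mul]; ring
    _ ≤ ∫ s in σ₀..σ₀ + Δ, muOf t₀ s := by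
        apply intervalIntegral.integral_mono_on (by linarith) intervalIntegrable_const hint
        intro s hs
        exact mu_lower t₀ ht₀ s ⟨by linarith [hs.1], by linarith [hs.2]⟩

/-! ### (iv) the chain under R#a breaks at the same-constant transfer (308) p.63 -/

/-- **`Step_6Abs` (the same-constant transfer (308) p.63) is FALSE** at `ρ = 1/2`, `t₀ = 0`, `t = 1/4`, `U = C = 1`
(`3/2 ≤ 5/4` fails) — conceded by the print's own Remark 6.7. -/
theorem not_Step_6Abs : ¬ Step_6Abs := by
  intro h
  have := h (1 / 2) 0 (1 / 4) 1 1 (by norm_num) (by norm_num) le_rfl (by norm_num) (by norm_num)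
    zero_le_one le_rfl
  norm_num at this

/-- The author's weak transfer (316), Remark 6.7 p.64, is true arithmetic. -/
theorem step_6Weak_holds : Step_6Weak := by
  intro ρ t₀ t U C hρ hρ1 ht₀ ht hU hUC
  have hτ : 1 + (t₀ + (t - t₀) / ρ) ≤ (1 + t) / ρ := by
    rw [le_div_iff₀ hρ]
    have h1 : t₀ * ρ ≤ t₀ := by nlinarith
    have h2 : (t - t₀) / ρ * ρ = t - t₀ := by field_simp
    nlinarith [h1, h2]
  calc (1 + (t₀ + (t - t₀) / ρ)) * U ≤ (1 + t) / ρ * U := by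
        exact mul_le_mul_of_nonneg_right hτ hU
    _ ≤ (1 + t) / ρ * C := by
        exact mul_le_mul_of_nonneg_left hUC (div_nonneg (by linarith) hρ.le)
    _ = (1 + t) * (C / ρ) := by ring

end Summit.NavierStokesRegularity.NavierStokesRegularity.Theorems.Kampen2014
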